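import Literature.AlgebraicGeometry.Resolution.GermsOfClosedSubsets
import HarnessLib

/-!
# The germ of a closed set which is locally the closure of a generisation

Topic: `Literature/AlgebraicGeometry/Resolution` (the dictionary "points of `Spec 𝒪_{X,v}` =
generisations of `v`", Stacks 01J7, continued from `SncStrata.lean` / `GermsOfClosedSubsets.lean`).
If a closed subset `Z` of a scheme `X` agrees near `v` with the closure of the generisation `η_𝔮`
of `v` defined by a prime `𝔮 ⊂ 𝒪_{X,v}` — on some open `U ∋ v`, `w ∈ Z ↔ η_𝔮 ⤳ w` — then the germ
of the ideal of `Z` at `v` IS `𝔮`: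

* `stalkIdeal_vanishingIdeal_eq_of_nhds_mem_iff_specializes` — `I(Z)_v = 𝔮`.

Proof: `I(Z)_v` is the vanishing ideal of the trace `{𝔮' | η_{𝔮'} ∈ Z}` of `Z` on `Spec 𝒪_{X,v}`
(`stalkIdeal_vanishingIdeal_eq_vanishingIdeal_setOf`); every `η_{𝔮'}` lies in `U`, so the trace is
`{𝔮' | η_𝔮 ⤳ η_{𝔮'}} = {𝔮' | 𝔮 ≤ 𝔮'} = V(𝔮)`, whose vanishing ideal is `√𝔮 = 𝔮`. This is the
input "stalk ideal of the centre" of the admissibility of the blow-up centres of the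
exceptionalisation game (`Summits/…/RadicialJungCleanModelsSufficeGameCentre*.lean`).

## Sources

* The Stacks Project, Tag 01J7 (points of `Spec 𝒪_{X,x}` are the generisations of `x`).
  [cite: StacksProject, Tag 01J7]
* A. Grothendieck, J. Dieudonné, *EGA I* (1960), 2.4.2.

Everything here is proved (from `SncStrata.lean` and Mathlib).
-/

noncomputable section

open CategoryTheory AlgebraicGeometry TopologicalSpace Topology IsLocalRing

universe u

namespace Literature.AlgebraicGeometry.Resolution

open Scheme.IdealSheafData

variable {X : Scheme.{u}} {v : X}

/-- **The trace on `Spec 𝒪_{X,v}` of a closed set which near `v` is the closure of `η_𝔮` is `V(𝔮)`.**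
[cite: StacksProject, Tag 01J7] -/
theorem fromSpecStalk_mem_iff_le_of_nhds_mem_iff_specializes {Z : Set X}
    (q : PrimeSpectrum (X.presheaf.stalk v)) {U : X.Opens} (hvU : v ∈ U)
    (hU : ∀ w ∈ U, w ∈ Z ↔ X.fromSpecStalk v q ⤳ w) (q' : PrimeSpectrum (X.presheaf.stalk v)) :
    X.fromSpecStalk v q' ∈ Z ↔ q.asIdeal ≤ q'.asIdeal := by
  have hq'U : X.fromSpecStalk v q' ∈ U := (fromSpecStalk_specializes q').mem_open U.isOpen hvU
  rw [hU _ hq'U, fromSpecStalk_specializes_iff_le]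

/-- **The germ of a closed set which is locally the closure of a generisation.** If on some open
`U ∋ v` the closed set `Z` is `{w | η_𝔮 ⤳ w}` for a prime `𝔮` of `𝒪_{X,v}`, then `I(Z)_v = 𝔮`.
[cite: StacksProject, Tag 01J7] -/
theorem stalkIdeal_vanishingIdeal_eq_of_nhds_mem_iff_specializes {Z : Set X} (hZ : IsClosed Z)
    (q : PrimeSpectrum (X.presheaf.stalk v)) {U : X.Opens} (hvU : v ∈ U)
    (hU : ∀ w ∈ U, w ∈ Z ↔ X.fromSpecStalk v q ⤳ w) :
    stalkIdeal (vanishingIdeal ⟨Z, hZ⟩) v = q.asIdeal := by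
  rw [stalkIdeal_vanishingIdeal_eq_vanishingIdeal_setOf]
  have hset : {q' : PrimeSpectrum (X.presheaf.stalk v) | X.fromSpecStalk v q' ∈ ((⟨Z, hZ⟩ : Closeds X) : Set X)} =
      PrimeSpectrum.zeroLocus (q.asIdeal : Set (X.presheaf.stalk v)) := by
    ext q'
    rw [Set.mem_setOf_eq, PrimeSpectrum.mem_zeroLocus, SetLike.coe_subset_coe]
    exact fromSpecStalk_mem_iff_le_of_nhds_mem_iff_specializes q hvU hU q'
  rw [hset, PrimeSpectrum.vanishingIdeal_zeroLocus_eq_radical, q.2.radical]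

end Literature.AlgebraicGeometry.Resolution

end
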